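import Summits.NavierStokesRegularity.NavierStokesRegularity.Theses.SymmetryModuliCount
import Summits.NavierStokesRegularity.NavierStokesRegularity.Theorems.MustSqueeze.Negative.WithoutOseen
import Summits.NavierStokesRegularity.NavierStokesRegularity.Theorems.MustSqueeze.Negative.GaussianVortex
import Literature.Analysis.FluidPDE.LocalTypeI

/-!
# Sketch (ideator 1, crux stmt-NavierStokesRegularity-4052 `ForcedSymmetry`, round 1)

First lemmas of the two idea cards `far-past-energy-ledger` and `blow-down-census`, stated over existing
declarations only.  Nothing here is proved except the trivial direction of the census transfer; the
file must merely ELABORATE (crux-ideate rule).  `H1 … H5` are the named clauses of the sister crux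
`MustSqueeze` (`Theorems/MustSqueeze/Negative/WithoutOseen.lean`): H1–H4 are verbatim the four clauses of
the class `A_C` of `ForcedSymmetry` (cf. `Cruxes/ForcedSymmetry/Disproof.lean`, `forcedSymmetry_iff`), and
H5 is the scale-invariant local energy bound `A, E ≤ K` on every backward parabolic cylinder.
-/

noncomputable section

namespace Summit.NavierStokesRegularity.NavierStokesRegularity.Cruxes.ForcedSymmetry.Ideator1

open MeasureTheory Set Function
open Literature.Analysis.FluidPDE
open Summit.NavierStokesRegularity.NavierStokesRegularity.Theses.SymmetryModuliCount
open Summit.NavierStokesRegularity.NavierStokesRegularity.Theorems.MustSqueeze.Negative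

/-- `ℝ³`. -/
abbrev E3 : Type := EuclideanSpace ℝ (Fin 3)

/-! ## Card 1 — far-past energy ledger -/

/-- LERAY-RATE ENERGY: the energy of `u(t,·)` in EVERY ball grows at most linearly in the radius,
uniformly in `t < 0` and in the centre (the rate of Leray's `|x|⁻¹` profile). -/
def LerayRateEnergy (K : ℝ) (u : ℝ → E3 → E3) : Prop :=
  ∀ t < 0, ∀ (x₀ : E3) (r : ℝ), 0 < r → ∫ x in Metric.ball x₀ r, ‖u t x‖ ^ 2 ≤ K * r

/-- The KNSS-gauge input used by the ledger, as explicit hypotheses on a pressure `p`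
(KNSS2009 §2–4 / Seregin2014Notes Prop. 3.9: `p = R_iR_j(u_iu_j) ∈ L∞(BMO)`, all derivatives bounded;
the same unproved input as the route's support item `JacobiFieldsTempered`):
(i) `(u,p)` is a classical Navier–Stokes pair on `t < 0`; (ii) the scale-invariant gradient bound;
(iii) the logarithmic pressure-oscillation bound on balls of radius `ρ ≥ √(−t)` (BMO + smoothness at
scale `√(−t)`). -/
def GaugePressure (C₁ C₂ : ℝ) (u : ℝ → E3 → E3) (p : ℝ → E3 → ℝ) : Prop :=
  ContDiffOn ℝ (⊤ : ℕ∞) (uncurry p) (Iio 0 ×ˢ univ) ∧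
  (∀ t < 0, ∀ x, timeDeriv u t x + convect (u t) (u t) x = Laplacian.laplacian (u t) x - gradient (p t) x) ∧
  (∀ t < 0, ∀ x, ‖fderiv ℝ (u t) x‖ ≤ C₁ / (-t)) ∧
  (∀ t < 0, ∀ (x₀ : E3) (ρ : ℝ), Real.sqrt (-t) ≤ ρ →
    ∀ x ∈ Metric.ball x₀ ρ, |p t x - p t x₀| ≤ C₂ / (-t) * (1 + Real.log (ρ / Real.sqrt (-t))))

/-- FIRST LEMMA of card 1 (ledger, step one — exponent `a = 2`): starting the local energy balance
on `B_R(x₀)` at the far-past time `s = −4R²` (where Type-I decay makes the initial energy `O(C²R)`)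
and bounding the three flux terms crudely gives
`∫_{B_R(x₀)} |u(t)|² ≤ K (R + R²/√(−t)) (1 + log(R/√(−t)))` for `R ≥ √(−t)`. -/
def FarPastLedgerStepOne : Prop :=
  ∀ (C C₁ C₂ : ℝ), ∃ K : ℝ, ∀ (u : ℝ → E3 → E3) (p : ℝ → E3 → ℝ),
    H1 u → H2 u → H3 u → H4 C u → GaugePressure C₁ C₂ u p →
    ∀ t < 0, ∀ (x₀ : E3) (R : ℝ), Real.sqrt (-t) ≤ R →
      ∫ x in Metric.ball x₀ R, ‖u t x‖ ^ 2 ≤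
        K * (R + R ^ 2 / Real.sqrt (-t)) * (1 + Real.log (R / Real.sqrt (-t)))

/-- THE LEDGER LEMMA (card 1, full statement after the two bootstrap steps `a : 2 → 1·log → 1`):
temporal Type I ⇒ Leray-rate energy AND the Albritton–Barker local-energy bounds H5, with a constant
depending only on `C, C₁, C₂`.  Consequence: `A_C ⊂ 𝒦_{K(C)}` (the class of `SqueezeCycle.MustSqueeze`)
and `𝐈(u) < ∞` for every `u ∈ A_C` — the implication Albritton–Barker 2019 Remark 3.2 leaves open. -/
def FarPastLedger : Prop :=
  ∀ (C C₁ C₂ : ℝ), ∃ K : ℝ, ∀ (u : ℝ → E3 → E3) (p : ℝ → E3 → ℝ),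
    H1 u → H2 u → H3 u → H4 C u → GaugePressure C₁ C₂ u p → LerayRateEnergy K u ∧ H5 K u

/-- Ledger family, momentum: the mean velocity over large balls is small (spherical means of the far
field vanish), `‖∫_{B_R(x₀)} u(t)‖ ≤ K R² (1 + log(R/√(−t)))²` for `R ≥ √(−t)` (trivial bound: `R³/√(−t)`). -/
def MomentumLedger : Prop :=
  ∀ (C C₁ C₂ : ℝ), ∃ K : ℝ, ∀ (u : ℝ → E3 → E3) (p : ℝ → E3 → ℝ),
    H1 u → H2 u → H3 u → H4 C u → GaugePressure C₁ C₂ u p →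
    ∀ t < 0, ∀ (x₀ : E3) (R : ℝ), Real.sqrt (-t) ≤ R →
      ‖∫ x in Metric.ball x₀ R, u t x‖ ≤ K * R ^ 2 * (1 + Real.log (R / Real.sqrt (-t))) ^ 2

/-- In-law variant of card 1 ("Liouville in law"): a translation-invariant Borel probability measure
on path space concentrated on `A_C` (with the gauge) is the Dirac mass at `0` — homogeneous statistics
have non-increasing energy density, Type-I decay makes it vanish at `t = −∞`. -/
def LiouvilleInLaw : Prop :=
  ∀ (C C₁ C₂ : ℝ) (μ : Measure (ℝ → E3 → E3)), IsProbabilityMeasure μ →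
    (∀ a : E3, MeasurePreserving (fun u : ℝ → E3 → E3 => fun t x => u t (x + a)) μ μ) →
    (∀ᵐ u ∂μ, H1 u ∧ H2 u ∧ H3 u ∧ H4 C u ∧ ∃ p, GaugePressure C₁ C₂ u p) →
    ∀ᵐ u ∂μ, ∀ t < 0, ∀ x, u t x = 0

/-! ## Card 2 — blow-down census -/

/-- A spiral scaling about the centre `x₀` with skew part `A` annihilates `u`: `L_ξ u ≡ 0` for
`ξ = (−x₀ − A x₀, σ = 1, A)` — i.e. `u` is ROTATED SELF-SIMILAR about `(0, x₀)`. -/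
def IsRSSAbout (u : ℝ → E3 → E3) (x₀ : E3) (A : E3 →L[ℝ] E3) : Prop :=
  ∀ t < 0, ∀ x, fderiv ℝ (u t) x ((x - x₀) + A (x - x₀)) + u t x + (2 * t) • timeDeriv u t x - A (u t x) = 0

/-- TRANSFER target of card 2: "Type I ⇒ rotated self-similar" on the class `A_C`. -/
def TypeIIsRSS : Prop :=
  ∀ (C : ℝ) (u : ℝ → E3 → E3), H1 u → H2 u → H3 u → H4 C u →
    ∃ (x₀ : E3) (A : E3 →L[ℝ] E3), (∀ x, inner ℝ (A x) x = 0) ∧ IsRSSAbout u x₀ A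

/-- FIRST LEMMA of card 2 (the census theorem, σ = 0 half of the stabiliser census): inside the
local-energy class (H5) a NON-SCALING continuous similarity symmetry — translation, screw/helical or
pure rotation: `ξ = (a, 0, A) ≠ 0` — is lethal.  Mechanism: blow-down `u ↦ k u(k²t, kx)` conjugates
`(a, 0, A)` to `(a/k, 0, A)`; Lin compactness (`SuitableCompactness`) + Rusin–Šverák persistence
(`PersistenceOfSingularities`) give a limit that is SINGULAR at the origin (hence nonzero) and invariant
under the limit subgroup; `A ≠ 0` ⇒ the limit is axisymmetric Type I singular — excluded by
`Barriers.NavierStokesRegularity.AxisymmetricTypeIExclusion`; `A = 0` ⇒ translation-invariant with a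
singular LINE at `t = 0` — excluded by CKN `𝒫¹(S) = 0` (`ckn_partial_regularity_holds`). -/
def NonScalingSymmetryIsLethal : Prop :=
  ∀ (C K : ℝ) (u : ℝ → E3 → E3), H1 u → H2 u → H3 u → H4 C u → H5 K u →
    ∀ (a : E3) (A : E3 →L[ℝ] E3), (∀ x, inner ℝ (A x) x = 0) → ¬ (a = 0 ∧ A = 0) →
      (∀ t < 0, ∀ x, fderiv ℝ (u t) x (a + A x) - A (u t x) = 0) → ∀ t < 0, ∀ x, u t x = 0

/-- The HELICAL leaf alone (pitch `h ≠ 0` about the `x₂`-axis; `rot` = the in-tree rotation generator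
`x ↦ (−x₁, x₀, 0)`), the open sub-case of the sister crux `SymmetricLiouville` that the census closes
first ("pitch collapse": blow-down sends `h ↦ h/k → 0`). -/
def HelicalLeafDies : Prop :=
  ∀ (C K h : ℝ) (u : ℝ → E3 → E3), H1 u → H2 u → H3 u → H4 C u → H5 K u → h ≠ 0 →
    (∀ t < 0, ∀ x, fderiv ℝ (u t) x (h • EuclideanSpace.single (2 : Fin 3) (1 : ℝ) + rot x) - rot (u t x) = 0) →
    ∀ t < 0, ∀ x, u t x = 0

/-- Discrete upgrade (census, lattice part): in the local-energy class a nonzero element has NO discrete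
translational symmetry either (blow-down turns the lattice `ℤa` into the line `ℝa`; persistence keeps
the limit singular at the origin; CKN forbids the resulting singular line). -/
def PeriodicLeafDiesInK : Prop :=
  ∀ (C K : ℝ) (u : ℝ → E3 → E3), H1 u → H2 u → H3 u → H4 C u → H5 K u →
    ∀ a : E3, a ≠ 0 → (∀ t < 0, ∀ x, u t (x + a) = u t x) → ∀ t < 0, ∀ x, u t x = 0

/-- The census TRANSFER: given the ledger (H5 is automatic on `A_C`) and the census theorem, the crux
`ForcedSymmetry` is EQUIVALENT to "Type I ⇒ rotated self-similar". (→ uses the census to discard every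
non-scaling `ξ`; ← is the trivial direction proved below.) -/
def CensusTransfer : Prop :=
  FarPastLedger → NonScalingSymmetryIsLethal → (ForcedSymmetry ↔ TypeIIsRSS)

/-- The trivial direction of the transfer: an RSS field has the nonzero symmetry `ξ = (−x₀ − A x₀, 1, A)`. -/
theorem forcedSymmetry_of_typeIIsRSS (h : TypeIIsRSS) : ForcedSymmetry := by
  intro C u hu
  obtain ⟨x₀, A, hA, hR⟩ := h C u hu.1 hu.2.1 hu.2.2.1 hu.2.2.2
  refine ⟨-x₀ - A x₀, 1, A, hA, fun hh => one_ne_zero hh.2.1, fun t ht x => ?_⟩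
  have key : (-x₀ - A x₀) + (1 : ℝ) • x + A x = (x - x₀) + A (x - x₀) := by
    rw [map_sub]; simp only [one_smul]; abel
  have := hR t ht x
  rw [key]
  simpa [one_smul] using this

end Summit.NavierStokesRegularity.NavierStokesRegularity.Cruxes.ForcedSymmetry.Ideator1
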